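import Summits.QuantumAdvantage.QuantumAdvantage.Theorems.NearExactIsExact.Negative.UntwistedSection

/-!
# `NearExactIsExact` (stmt-QuantumAdvantage-14043) — negative lemma, gen 42 (part 1/2):
  the reflected pair identity and the parity core of THEOREM ZP

**Context.** In the last Maiorana–McFarland habitat of `NearExactIsExact` (BQ-11, DISPROOF.md §10,
§24, §43–§48 of the b2b cell) one needs a biquadratic permutation `π` of `𝔽₂^{6+r}` and cubics
`c₁, c₂` with residual `c₁ ⊕ c₂∘π = 1_{u = 0}`; in normal form `π(u,w) = (γ u, B(u) ⊕ M(u)·w)` with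
`γ` affine except ONE coordinate `i₀` of degree `≤ 2`, `B` quadratic, `M(u)` an affine family of
invertible matrices. THEOREM TT (`Negative.TwistedTranslation`, gen 38) kills `M ≡ I` by expanding
`c₂(γu, ·)` around the zero section and counting degrees; for a general frame that arrangement loses
a degree.

**What this file proves (all `r`, no computation).** `reflected_pair_identity`: for a cubic `c`,
`x ∈ 𝔽₂⁶`, `b ∈ 𝔽₂^r`,
`c(x,0) = c(x,b) + Σ_a b_a·(c(x,b) ⊕ c(x, b ⊕ e_a)) + Σ_{|T|=2} b_T · C_T(x)` in `𝔽₂`,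
`C_T = coefC c T` the `t`-Möbius PAIR coefficient of `c` at the ZERO section — the pair identity
`texp_split` of THEOREM TT applied to the TRANSLATE `z ↦ c(z ⊕ (0‖b))`, whose second differences at
`b` are those of `c` at `0`. And the parity core `zeroSection_core` of THEOREM ZP: with `x = γ u`,
`b = B u`, if `u ↦ c₂(γu, B u) ⊕ 1_{u=0}` and each `u ↦ B_a(u)·(c₂(γu,Bu) ⊕ c₂(γu, Bu ⊕ e_a))` have
degree `≤ 5` (even weight, Ax), then — since `deg c₂(γu, 0) ≤ 4` and `1_{u=0}` is odd —
`Σ_u Σ_{|T|=2} B_T(u)·C_T(γ u) = 1`. Part 2 (`Negative.ZeroSectionParity`) feeds the residual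
identity on the zero section and on `r` affine sections into this core and puts it in closed form.

HONEST FRAMING: the value here is a THEOREM (kernel-checked identities for the negative-lemma lane of
`NearExactIsExact`), NOT summit progress; the crux and the summit are untouched.
-/

set_option linter.dupNamespace false -- D-0017: single-problem summit ⇒ `QuantumAdvantage.QuantumAdvantage` by design

namespace Summit.QuantumAdvantage.QuantumAdvantage.Theorems.NearExactIsExact.Negative.ReflectedPairIdentity


open Finset
open Literature.Computability.QuantumComplexity
open Literature.Computability.QuantumComplexity.BuzetChailloux (bxor)
open Summit.QuantumAdvantage.QuantumAdvantage.Theorems.CubicForrelation.NearExactIsExact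
  (fc_isDegLeFun_comp stub_derivDegree tc_const_of_deg_zero fc_deg_bxor te_isDegLeFun_band)
open Summit.QuantumAdvantage.QuantumAdvantage.Theorems.NearExactIsExact.Negative.SkewProductCore
open Summit.QuantumAdvantage.QuantumAdvantage.Theorems.NearExactIsExact.Negative.SkewProductResidual
open Summit.QuantumAdvantage.QuantumAdvantage.Theorems.NearExactIsExact.Negative.TwistedTranslation
open Summit.QuantumAdvantage.QuantumAdvantage.Theorems.NearExactIsExact.Negative.UntwistedSection (sum_ind_delta)

variable {r : ℕ}

/-! ### Fibre translates of a cubic -/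

/-- `(x ‖ w) ⊕ (0 ‖ b) = (x ‖ w ⊕ b)`, the shift vector `(0 ‖ b)` written as `L (supp b)`. [folklore] -/
theorem append_bxor_L_supp (x : Fin 6 → Bool) (w b : Fin r → Bool) :
    bxor (Fin.append x w) (L (supp b)) = Fin.append x (fun k => w k ^^ b k) := by
  funext j
  induction j using Fin.addCases with
  | left i => simp [bxor, L]
  | right k => simp [bxor, L, indic_supp]

/-- A translate `z ↦ c (z ⊕ v)` of a cubic is cubic. [folklore] -/
theorem isDegLeFun_shift (c : (Fin (6 + r) → Bool) → Bool) (hc : IsDegLeFun 3 c)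
    (v : Fin (6 + r) → Bool) : IsDegLeFun 3 (fun z => c (bxor z v)) :=
  fc_isDegLeFun_comp hc (fun z => bxor z v)
    (fun j => show IsDegLeFun 1 (fun z : Fin (6 + r) → Bool => z j ^^ v j) from
      fc_deg_bxor (isDegLeFun_apply j le_rfl) (isDegLeFun_const 1 (v j)))
    (le_of_eq (one_mul 3))

/-- `Σ_{|S| ≤ 1} f S = f ∅ + Σ_a f {a}`. [folklore] -/
theorem sum_P3_card_le_one (f : Finset (Fin r) → ZMod 2) :
    ∑ S ∈ (P3 r).filter (fun S => S.card ≤ 1), f S = f ∅ + ∑ a, f {a} := by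
  have hset : (P3 r).filter (fun S => S.card ≤ 1) =
      insert ∅ ((univ : Finset (Fin r)).map ⟨fun a => ({a} : Finset (Fin r)), singleton_injective⟩) := by
    ext S
    simp only [mem_filter, mem_P3, mem_insert, mem_map, mem_univ, true_and,
      Function.Embedding.coeFn_mk]
    constructor
    · rintro ⟨-, h1⟩
      rcases Nat.le_one_iff_eq_zero_or_eq_one.mp h1 with h | h
      · exact Or.inl (card_eq_zero.mp h)
      · obtain ⟨a, rfl⟩ := card_eq_one.mp h
        exact Or.inr ⟨a, rfl⟩
    · rintro (rfl | ⟨a, rfl⟩)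
      · simp
      · simp
  have hnot : (∅ : Finset (Fin r)) ∉
      (univ : Finset (Fin r)).map ⟨fun a => ({a} : Finset (Fin r)), singleton_injective⟩ := by
    simp only [mem_map, mem_univ, true_and, Function.Embedding.coeFn_mk, not_exists]
    intro a h
    exact singleton_ne_empty a h
  rw [hset, sum_insert hnot, sum_map]
  rfl

/-! ### The reflected pair identity -/

/-- **Reflected pair identity.** For a cubic `c` on `6 + r` bits, `x ∈ 𝔽₂⁶`, `b ∈ 𝔽₂^r`:
`c(x,0) = c(x,b) + Σ_a b_a·(c(x, b ⊕ e_a) ⊕ c(x,b)) + Σ_{|T|=2} b_T · C_T(x)` in `𝔽₂`, with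
`C_T = coefC c T` the pair coefficient at the zero section (the pair identity `texp_split` of THEOREM TT
applied to the translate `z ↦ c(z ⊕ (0‖b))`, whose second differences at `b` are those of `c` at `0`).
[folklore] -/
theorem reflected_pair_identity (c : (Fin (6 + r) → Bool) → Bool) (hc : IsDegLeFun 3 c)
    (x : Fin 6 → Bool) (b : Fin r → Bool) :
    ind (c (Fin.append x (fun _ => false))) =
      ind (c (Fin.append x b)) +
      ∑ a, ind (b a) * ind (c (Fin.append x b) ^^ c (Fin.append x (fun k => decide (k = a) ^^ b k))) +
      ∑ T ∈ (univ : Finset (Fin r)).powersetCard 2, (∏ m ∈ T, ind (b m)) * ind (coefC c T x) := by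
  -- the translate and its values on the fibre over `x`
  have hc' : IsDegLeFun 3 (fun z => c (bxor z (L (supp b)))) := isDegLeFun_shift c hc (L (supp b))
  have hval : ∀ w : Fin r → Bool,
      (fun z => c (bxor z (L (supp b)))) (Fin.append x w) = c (Fin.append x (fun k => w k ^^ b k)) := by
    intro w
    show c (bxor (Fin.append x w) (L (supp b))) = _
    rw [append_bxor_L_supp]
  have hemb : ∀ y : Fin 6 → Bool, emb r y = Fin.append y (fun _ => false) := fun y => rfl
  -- the pair identity for the translate, at `ρ = b`
  have hsplit := texp_split (fun m (_ : Fin 6 → Bool) => b m)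
    (fun S (_ : Fin 6 → Bool) => coefC (fun z => c (bxor z (L (supp b)))) S x) x
  -- left-hand side: `c'(x,b) = c(x,0)`
  have hL : texp (fun S (_ : Fin 6 → Bool) => coefC (fun z => c (bxor z (L (supp b)))) S x) (fun m => b m) x =
      ind (c (Fin.append x (fun _ => false))) := by
    have e : texp (fun S (_ : Fin 6 → Bool) => coefC (fun z => c (bxor z (L (supp b)))) S x) (fun m => b m) x =
        texp (coefC (fun z => c (bxor z (L (supp b))))) b x := rfl
    have e0 : (fun k => b k ^^ b k) = (fun _ : Fin r => false) := funext fun k => Bool.xor_self _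
    rw [e, ← expand _ hc' x b]
    show ind (c (bxor (Fin.append x b) (L (supp b)))) = _
    rw [append_bxor_L_supp, e0]
  -- the `|S| ≤ 1` block
  have h1 : ∑ S ∈ (P3 r).filter (fun S => S.card ≤ 1),
      (∏ m ∈ S, ind (b m)) * ind (coefC (fun z => c (bxor z (L (supp b)))) S x) =
      ind (c (Fin.append x b)) +
      ∑ a, ind (b a) * ind (c (Fin.append x b) ^^ c (Fin.append x (fun k => decide (k = a) ^^ b k))) := by
    rw [sum_P3_card_le_one (fun S => (∏ m ∈ S, ind (b m)) * ind (coefC (fun z => c (bxor z (L (supp b)))) S x))]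
    have hd0 : ∀ z, dsum (fun z => c (bxor z (L (supp b)))) ∅ z = c (bxor z (L (supp b))) := by
      intro z; simp only [dsum, powerset_empty, sum_singleton, bxor_L_empty, decide_ind_eq_one]
    have h0 : coefC (fun z => c (bxor z (L (supp b)))) ∅ x = c (Fin.append x b) := by
      rw [coefC, hd0, hemb, append_bxor_L_supp]
      simp only [Bool.false_xor]
    have ha : ∀ a : Fin r, coefC (fun z => c (bxor z (L (supp b)))) {a} x =
        (c (Fin.append x b) ^^ c (Fin.append x (fun k => decide (k = a) ^^ b k))) := by
      intro a
      show dsum (fun z => c (bxor z (L (supp b)))) {a} (emb r x) = _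
      rw [← insert_empty, dsum_insert _ (notMem_empty a)]
      show (dsum (fun z => c (bxor z (L (supp b)))) ∅ (emb r x) ^^
        dsum (fun z => c (bxor z (L (supp b)))) ∅ (bxor (emb r x) (dir a))) = _
      rw [hd0, hd0, emb_bxor_dir, append_bxor_L_supp, hemb, append_bxor_L_supp]
      simp only [Bool.false_xor]
    simp only [prod_empty, one_mul, prod_singleton, h0, ha]
  -- the pair block: second differences of the translate at `b` are those of `c` at `0`
  have h2 : ∀ T ∈ (univ : Finset (Fin r)).powersetCard 2,
      (∏ m ∈ T, ind (b m)) * (∑ S ∈ (P3 r).filter (fun S => T ⊆ S),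
        (∏ m ∈ S \ T, ind (b m)) * ind (coefC (fun z => c (bxor z (L (supp b)))) S x)) =
      (∏ m ∈ T, ind (b m)) * ind (coefC c T x) := by
    intro T _
    congr 1
    rw [tTcoef_eq (fun m (_ : Fin 6 → Bool) => b m)
      (fun S (_ : Fin 6 → Bool) => coefC (fun z => c (bxor z (L (supp b)))) S x) T x]
    have hJ : ∀ J ∈ T.powerset,
        texp (fun S (_ : Fin 6 → Bool) => coefC (fun z => c (bxor z (L (supp b)))) S x)
          (fun m => decide (m ∈ J) ^^ b m) x = ind (c (Fin.append x (indic J))) := by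
      intro J _
      have e : texp (fun S (_ : Fin 6 → Bool) => coefC (fun z => c (bxor z (L (supp b)))) S x)
          (fun m => decide (m ∈ J) ^^ b m) x =
          texp (coefC (fun z => c (bxor z (L (supp b))))) (fun m => decide (m ∈ J) ^^ b m) x := rfl
      have eJ : (fun k => (decide (k ∈ J) ^^ b k) ^^ b k) = indic J := by
        funext k; rw [Bool.xor_assoc, Bool.xor_self, Bool.xor_false]; rfl
      rw [e, ← expand _ hc' x]
      show ind (c (bxor (Fin.append x (fun m => decide (m ∈ J) ^^ b m)) (L (supp b)))) = _
      rw [append_bxor_L_supp, eJ]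
    rw [sum_congr rfl hJ]
    simp only [coefC, dsum, ind_decide_eq_one, emb_bxor_L]
  rw [hL, h1, sum_congr rfl h2] at hsplit
  exact hsplit

/-! ### The parity core of THEOREM ZP -/

/-- `p ⊕ q = d ⇒ q ⊕ d = p`. [folklore] -/
theorem bool_aux1 : ∀ p q d : Bool, (p ^^ q) = d → (q ^^ d) = p := by decide

/-- Two residual identities with the same right-hand side: `q ⊕ q' = p ⊕ p'`. [folklore] -/
theorem bool_aux2 : ∀ p q p' q' d : Bool, (p ^^ q) = d → (p' ^^ q') = d → (q ^^ q') = (p ^^ p') := by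
  decide

/-- The coordinates of an affine section `u ↦ (u ‖ t u)` are affine. [folklore] -/
theorem section_coord_deg (t : (Fin 6 → Bool) → Fin r → Bool) (ht : ∀ k, IsDegLeFun 1 (fun u => t u k)) :
    ∀ j : Fin (6 + r), IsDegLeFun 1 (fun u : Fin 6 → Bool => Fin.append u (t u) j) := by
  intro j
  induction j using Fin.addCases with
  | left i =>
    have e : (fun u : Fin 6 → Bool => Fin.append u (t u) (Fin.castAdd r i)) = fun u => u i :=
      funext fun u => Fin.append_left u _ i
    rw [e]
    exact isDegLeFun_apply i le_rfl
  | right k =>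
    have e : (fun u : Fin 6 → Bool => Fin.append u (t u) (Fin.natAdd 6 k)) = fun u => t u k :=
      funext fun u => Fin.append_right u _ k
    rw [e]
    exact ht k

/-- **THEOREM ZP, abstract core.** `γ` affine except coordinate `i₀` of degree `≤ 2`, `B_k`
quadratic, `c₂` cubic; if `u ↦ c₂(γu, B u) ⊕ 1_{u=0}` and every `u ↦ B_a(u)·(c₂(γu, Bu ⊕ e_a) ⊕
c₂(γu, B u))` have degree `≤ 5`, then `Σ_u Σ_{|T|=2} B_T(u)·C_T(γu) = 1`. [folklore] -/
theorem zeroSection_core (γ : (Fin 6 → Bool) → (Fin 6 → Bool)) (i₀ : Fin 6)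
    (hγa : ∀ i, i ≠ i₀ → IsDegLeFun 1 (fun u => γ u i)) (hγq : IsDegLeFun 2 (fun u => γ u i₀))
    (B : Fin r → (Fin 6 → Bool) → Bool)
    (c₂ : (Fin (6 + r) → Bool) → Bool) (h₂ : IsDegLeFun 3 c₂)
    (hZ : IsDegLeFun 5 (fun u => c₂ (Fin.append (γ u) (fun k => B k u)) ^^ decide (∀ i, u i = false)))
    (hS : ∀ a, IsDegLeFun 5 (fun u => B a u &&
      (c₂ (Fin.append (γ u) (fun k => B k u)) ^^ c₂ (Fin.append (γ u) (fun k => decide (k = a) ^^ B k u))))) :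
    ∑ u, ∑ T ∈ (univ : Finset (Fin r)).powersetCard 2,
      (∏ m ∈ T, ind (B m u)) * ind (coefC c₂ T (γ u)) = 1 := by
  -- sum the reflected pair identity over `u`
  have hid : ∀ u : Fin 6 → Bool, ind (c₂ (Fin.append (γ u) (fun _ => false))) =
      ind (c₂ (Fin.append (γ u) (fun k => B k u))) +
      ∑ a, ind (B a u) * ind (c₂ (Fin.append (γ u) (fun k => B k u)) ^^
        c₂ (Fin.append (γ u) (fun k => decide (k = a) ^^ B k u))) +
      ∑ T ∈ (univ : Finset (Fin r)).powersetCard 2, (∏ m ∈ T, ind (B m u)) * ind (coefC c₂ T (γ u)) :=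
    fun u => reflected_pair_identity c₂ h₂ (γ u) (fun k => B k u)
  have hsum := sum_congr rfl fun u (_ : u ∈ (univ : Finset (Fin 6 → Bool))) => hid u
  rw [sum_add_distrib, sum_add_distrib] at hsum
  -- (L) `u ↦ c₂(γ u, 0) = (C_∅ ∘ γ)(u)` has degree ≤ 4: even weight
  have hL : ∑ u, ind (c₂ (Fin.append (γ u) (fun _ => false))) = 0 := by
    have h := coefC_deg c₂ h₂ (∅ : Finset (Fin r))
    rw [card_empty] at h
    have h4 := (isDegLeFun_comp_twist (d := 2) h γ i₀ hγa hγq).mono (show 2 + 2 ≤ 5 by norm_num)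
    have h0 := sum_ind_eq_zero_of_deg_five h4
    have e : ∀ u, coefC c₂ (∅ : Finset (Fin r)) (γ u) = c₂ (Fin.append (γ u) (fun _ => false)) := by
      intro u
      simp only [coefC, dsum, powerset_empty, sum_singleton, bxor_L_empty, decide_ind_eq_one]
      rfl
    simpa only [e] using h0
  -- (Z) the zero-section term has odd weight
  have hZ' : ∑ u, ind (c₂ (Fin.append (γ u) (fun k => B k u))) = 1 := by
    have h0 := sum_ind_eq_zero_of_deg_five hZ
    have e : ∀ u : Fin 6 → Bool, ind (c₂ (Fin.append (γ u) (fun k => B k u))) =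
        ind (c₂ (Fin.append (γ u) (fun k => B k u)) ^^ decide (∀ i, u i = false)) +
          ind (decide (∀ i, u i = false)) := by
      intro u
      rw [ind_xor]
      generalize ind (c₂ (Fin.append (γ u) fun k => B k u)) = p
      generalize ind (decide (∀ i, u i = false)) = q
      rw [add_assoc, CharTwo.add_self_eq_zero, add_zero]
    rw [sum_congr rfl (fun u _ => e u), sum_add_distrib, h0, sum_ind_delta, zero_add]
  -- (S) each section term has even weight
  have hS' : ∑ u, ∑ a, ind (B a u) * ind (c₂ (Fin.append (γ u) (fun k => B k u)) ^^
      c₂ (Fin.append (γ u) (fun k => decide (k = a) ^^ B k u))) = 0 := by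
    rw [sum_comm]
    refine sum_eq_zero fun a _ => ?_
    have h0 := sum_ind_eq_zero_of_deg_five (hS a)
    simpa only [ind_and] using h0
  rw [hL, hZ', hS'] at hsum
  -- `0 = 1 + 0 + X` in `𝔽₂`
  have fin : ∀ X : ZMod 2, 0 = 1 + 0 + X → X = 1 := by decide
  exact fin _ hsum

end Summit.QuantumAdvantage.QuantumAdvantage.Theorems.NearExactIsExact.Negative.ReflectedPairIdentity
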